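/-
Copyright (c) 2026 the pub-hodgecm2 formalisation cell (harness21).  New file, outside the frozen port manifest.
COR-CM (cell pub-hodgecm2, stage 2 of the Hodge ladder) — Δ2 BRIDGE, WALL-BREAKER 2 §3 (the WALL CERTIFICATE at the conjugate instance).
Statement: seat d2bridge-wb-2 g0 (desk statement file `HOME/d2bridge/wb-2/WB2S1Rekey.statement.lean`, sha256:bc6a40f069f14f42, §3,
VERBATIM).  Proof and filing: seat item6-p2 gen 21 (prover-pub-hodgecm2-item6-p2-g21-0), pairing wb-2 under the coordinator's
(c)+(d) fan-out (pub-hodgecm2/INBOX l. 11452).  Theorems only; no definition, no instance, no named fact, no `sorry`; count-neutral.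
FRAMING: HC_CM is NOT proved; «Δ2 BRIDGE CLOSED» is NOT claimed; no pointer, label or count moves.
-/
import Summits.HodgeConjecture.CorCM.D2Bridge.HcmS1PinJunction
import Literature.NumberTheory.Automorphic.Liu2021.Def45EtaConjugate
import Literature.NumberTheory.ComplexMultiplication.ReflexCMTypeOrientation
import Literature.NumberTheory.ComplexMultiplication.CMGaloisSubfield
import Literature.NumberTheory.ComplexMultiplication.CMTypeBasic
import Literature.AlgebraicGeometry.HodgeTheory.HodgeTypePullback
import Literature.AlgebraicGeometry.HodgeTheory.HodgeTypeVanishing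
import HarnessLib

set_option autoImplicit false

/-!
# Δ2 bridge, S1 re-key (wall-breaker 2) §3: the wall certificate at the conjugate instance

[Liu2021] Y. Liu, *Fourier–Jacobi cycles and arithmetic relative trace formula*, Camb. J. Math. **9** (2021) = arXiv:2102.11518,
Def. 4.3 (2) (`FJcycle.tex` l. 1919), Rem. 4.4 (ll. 1930–1933: «`Ψ_{μ^c}` is the opposite CM type of `Ψ_μ`»), Def. 4.5 (1)–(2)
(ll. 1939–1951), proof of Thm. 4.18 (l. 2250: «the maximal subspace of `H¹_{B,τ'}(A_μ, ℂ)` over which `M_μ` acts via the inclusion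
`M_μ ↪ ℂ` … a basis `α`»).  [Shimura1998] §5.2 (pp. 36–37), §8.3 Prop. 28.  [VoisinHodgeI2002] §7.3.2, Cor. 6.14.

WHAT IS PROVED.  `not_exists_dLiu_isReflexOfTypeG_of_conj_instance`: for `L/ℚ` Galois CM, the pin `ι₁`, `ῑ₁ := conj ∘ ι₁`, a
conjugate-symplectic weight-one `μ` WITH `ι₁ ∈ Φ_μ` (the dictionary's `PhiMu`), the one object `D : ObjOne (AlgHom.id ℚ L) ι₁ …` of the
rest of record and a non-zero inclusion-eigenclass `α₀ ∈ ℂ ⊗ H¹_B(A_μ ⊗_{L,ῑ₁} ℂ; ℚ)` — the complexification taken along the CONJUGATE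
instance `algebraMap = ῑ₁` — there is NO `ℚ`-family of model CM records `dLiu q` admissible in the dictionary's `ι₁`-reading for `Φ_μ`
(`IsReflexOfTypeG ι₁ Φ_μ`) with an S4 transport law `(f ≫ u q)^* (dLiu q).α = q • f^* α₀`: the conclusion of the tree's S1 junction
`exists_dLiu_of_objOne` (`CorCM/D2Bridge/HcmS1PinJunction.lean`) is FALSE once its `hinst : algebraMap = ι₁` is replaced by `algebraMap = ῑ₁`.

PROOF (a Hodge-type obstruction; every ingredient a tree theorem):
* `(0,1)`: by [Liu2021] Def. 4.5 (2) first bullet AS TYPED (`Def45.CMDatum.det45`, keyed by `η_μ` through `ι₁`) and the tree's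
  `Def45.eta_starRingEnd_comp` (`η_μ` through `ῑ₁` = `η_μ` through `ι₁`, `Liu2021/Def45EtaConjugate.lean`), the principal model of
  `A_μ ⊗_{ῑ₁} ℂ` realises the induced reflex type PRESENTED THROUGH `ῑ₁` (`exists_principal_isCMTypeRealisation_baseChange_of_det45` at
  `σ := ῑ₁`), which is the CONJUGATE type `bar Ψ̃^{ι₁}` (`Def45.inducedCMType_incl_conjugate`, Rem. 4.4); the inclusion character
  `τ₀ : M_μ ⊆ ℂ` lies IN `Ψ̃^{ι₁}` because `ι₁ ∈ Φ_μ` (`comp_smul_val_mem_reflexCMType_id_iff` at `g = 1`), hence NOT in `bar Ψ̃^{ι₁}`;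
  so the transport of `α₀` to the principal model is of Hodge type `(0,1)` (`IsCMTypeRealisation`, clause `σ ∉ Φ`), and so is `α₀`
  (pull-backs preserve Hodge types, `u^* v^* = m`).
* `(1,0)`: an `ι₁`-`Φ_μ`-admissible record `d` with `ι₁ ∈ Φ_μ` has `d.τ ∈ d.ΦA` (the orientation lemma of own-crow's audit file
  `OrientationReflexConj.lean`, re-derived here as a private lemma: witness `g = 1 ∈ S̃*`), so `d.α` is of type `(1,0)`
  (`IsCMTypeRealisation`, clause `σ ∈ Φ`, through `map_eigenline_complexify`); the S4 law at `q = 1`, `f = 𝟙` reads `u^* d.α = α₀`, so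
  `α₀` is of type `(1,0)` as well (`IsOfHodgeType.map_of_independent`).
* A class of two different Hodge types is zero (`IsOfHodgeType.eq_zero_of_ne`), contradicting `α₀ ≠ 0`.

Provenance: statement by d2bridge-wb-2 g0 (2026-08-23, `WB2S1Rekey.statement.lean` §3); proof by item6-p2 gen 21.  HC_CM is NOT proved.
-/

noncomputable section

open scoped TensorProduct

namespace Summit.HodgeConjecture.CorCM.D2Bridge

open CategoryTheory NumberField NumberField.ComplexEmbedding
open Literature.AlgebraicGeometry.Motives Literature.AlgebraicGeometry.HodgeTheory
open Literature.AlgebraicGeometry.ComplexMultiplication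
open Literature.NumberTheory.ComplexMultiplication Literature.NumberTheory.Automorphic
open Literature.NumberTheory.ComplexMultiplication.CMTypeOps (bar mem_bar_iff)
open Literature.NumberTheory.Automorphic.IdeleClassGroup Literature.NumberTheory.Automorphic.PicardCM
open Literature.NumberTheory.Automorphic.Liu2021 Literature.NumberTheory.Automorphic.Liu2021.AppendixC.RestOne
open HodgeCM.Model (LiuCMSide)
open HodgeCM.Model.LiuCMSide (autImage reflexFieldOf reflexTypeC autSet)
open Literature.AlgebraicGeometry.Milne1999 Literature.AlgebraicGeometry.Motives.AbelianVariety
open Summit.HodgeConjecture.CorCM.Model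

/-! ## §3a  Orientation of an `ι₁`-admissible record (own-crow's audit lemma, re-derived privately) -/

section Orientation

variable {L : HodgeCM.CMField} (ι₁ : L →+* ℂ)

/-- `1 ∈ autSet ι₁ Φ ↔ ι₁ ∈ Φ`.  (Adapted from own-crow g93's desk file `HOME/d2bridge/own-crow/OrientationReflexConj.lean`.) [folklore] -/
private theorem one_mem_autSet_iff' (Φ : CMType L) : (1 : L ≃ₐ[ℚ] L) ∈ autSet ι₁ Φ ↔ ι₁ ∈ Φ.1 := by
  change ι₁.comp (1 : L ≃ₐ[ℚ] L).toRingEquiv.toRingHom ∈ Φ.1 ↔ ι₁ ∈ Φ.1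
  exact Iff.of_eq (congrArg (fun χ => χ ∈ Φ.1) (RingHom.ext fun _ => rfl))

/-- `ι₁ ∘ incl ∈ reflexTypeC ι₁ (autSet ι₁ Φ)` as soon as `ι₁ ∈ Φ` (witness `g = 1 ∈ S̃*`).  (Adapted from own-crow g93.)
[cite: Shimura1998, §8.3 Prop. 28] -/
private theorem comp_algebraMap_mem_reflexTypeC_of_mem' (Φ : CMType L) (hι : ι₁ ∈ Φ.1) :
    ι₁.comp (algebraMap (↥(reflexFieldOf (autSet ι₁ Φ))) L) ∈ reflexTypeC ι₁ (autSet ι₁ Φ) := by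
  refine ⟨1, ?_, RingHom.ext fun _ => rfl⟩
  rw [mem_reflexLift, inv_one, one_smul]
  exact ⟨1, (one_mem_autSet_iff' ι₁ Φ).2 hι, rfl⟩

/-- **Orientation of admissible records** (own-crow g93's audit lemma): if `d.IsReflexOfType ι₁ Φ` and `ι₁ ∈ Φ`, then `d.τ ∈ d.ΦA` —
so by `IsCMTypeRealisation` the class `d.α` is of Hodge type `(1,0)`.  (Adapted from `OrientationReflexConj.lean`.)
[cite: Liu2021, Definition 4.3 (TeX ll. 1914–1921)] [cite: Shimura1998, §8.3 Prop. 28] -/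
private theorem tau_mem_cmType_of_isReflexOfType' (d : LiuCMSide) (Φ : CMType L) (h : d.IsReflexOfType ι₁ Φ)
    (hι : ι₁ ∈ Φ.1) : d.τ ∈ d.ΦA.1 := by
  refine (d.hΦA d.τ).2 ?_
  obtain ⟨ε, h1, h2⟩ := h
  rw [h2, h1]
  have hcomp : ((ι₁.comp (algebraMap (↥(reflexFieldOf (autSet ι₁ Φ))) L)).comp ε.toRingHom).comp ε.symm.toRingHom =
      ι₁.comp (algebraMap (↥(reflexFieldOf (autSet ι₁ Φ))) L) :=
    RingHom.ext fun x => by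
      simp only [RingHom.coe_comp, Function.comp_apply, RingEquiv.toRingHom_eq_coe, RingHom.coe_coe, RingEquiv.apply_symm_apply]
  rw [hcomp]
  exact comp_algebraMap_mem_reflexTypeC_of_mem' ι₁ Φ hι

end Orientation

/-! ## §3b  The inclusion character lies in the induced reflex type `Ψ̃^{ι₁}` when `ι₁ ∈ Φ_μ` -/

section Inclusion

variable {L : Type} [Field L] [NumberField L] [IsCMField L] [IsGalois ℚ L] (ι₁ : L →+* ℂ)
  {μ : Literature.NumberTheory.Automorphic.IdeleClassGroup L →ₜ* Circle} (hμ : IsConjugateSymplectic L μ)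

/-- **`(M_μ ⊆ ℂ) ∈ Ψ̃^{ι₁}_μ` when `ι₁ ∈ Φ_μ`**: the inclusion character of `M_μ` restricted along `e_μ = Def45.incl` to the presented
reflex field `K*_μ` is `ι₁|_{K*}`, which lies in the complex reflex type `reflexCMType ι₁ Φ_μ id` exactly when `ι₁ ∘ 1⁻¹ = ι₁ ∈ Φ_μ`
(`comp_smul_val_mem_reflexCMType_id_iff` at `g = 1`). [cite: Shimura1998, §8.3 Prop. 28] [cite: Liu2021, Def. 4.3 (2) (l. 1919)] -/
theorem subtype_mem_inducedCMType_incl_of_mem (hΦ : ι₁ ∈ hμ.cmType.1) :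
    (muAlgValueField L μ).subtype ∈
      (inducedCMType (Def45.incl (AlgHom.id ℚ L) ι₁ hμ) (reflexCMType ι₁ hμ.cmType (AlgHom.id ℚ L))).1 := by
  rw [mem_inducedCMType_iff]
  have hc : (muAlgValueField L μ).subtype.comp (Def45.incl (AlgHom.id ℚ L) ι₁ hμ) =
      ι₁.comp (((1 : L ≃ₐ[ℚ] L) • (reflexField ℚ L (algValuedIn ι₁ hμ.cmType.1)).val :
        reflexField ℚ L (algValuedIn ι₁ hμ.cmType.1) →ₐ[ℚ] L) : reflexField ℚ L (algValuedIn ι₁ hμ.cmType.1) →+* L) :=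
    RingHom.ext fun k => by
      rw [RingHom.comp_apply, Subfield.subtype_apply, Def45.coe_incl]
      rfl
  rw [hc, comp_smul_val_mem_reflexCMType_id_iff]
  have h1 : ι₁.comp ((1 : L ≃ₐ[ℚ] L).symm : L →+* L) = ι₁ := RingHom.ext fun _ => rfl
  rw [h1]
  exact hΦ

end Inclusion

/-! ## §3c  The wall certificate -/

section Junction

variable {L : HodgeCM.CMField} [IsGalois ℚ L] (ι₁ : L →+* ℂ)
  {μ : Literature.NumberTheory.Automorphic.IdeleClassGroup L →ₜ* Circle} (hμ : IsConjugateSymplectic L μ)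
  (hw : HasWeight L μ 1) (Car : Def45.Carriers L μ)

/-- Currency (instance-generic twin of `baseChange_hOneAlgHom_of_lineModuleOne`): an eigen-law for `α₀` in the J-record's currency
(`lineModuleOne`, `fieldOfValues L μ`) IS the `hOneAlgHom` eigen-law over `muAlgValueField L μ` for `i_{μ,ℂ} := End⁰(base change) ∘ i_μ`,
for ANY `Algebra L ℂ`. [cite: Liu2021, §4.1 (FJcycle.tex l. 1926–1928) and proof of Thm. 4.18 (l. 2250)] -/
private theorem baseChange_hOneAlgHom_of_lineModuleOne' [Algebra (L : Type) ℂ] (D : ObjOne (AlgHom.id ℚ L) ι₁ hμ hw Car)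
    (α₀ : ℂ ⊗[ℚ] bettiCohomology (AμC (AlgHom.id ℚ L) ι₁ hμ hw Car D).X 1)
    (hα₀ : letI := lineModuleOne (AlgHom.id ℚ L) ι₁ hμ hw Car D
      ∀ s : fieldOfValues L μ,
        (DistribSMul.toLinearMap ℚ (bettiCohomology (AμC (AlgHom.id ℚ L) ι₁ hμ hw Car D).X 1) s).baseChange ℂ α₀ =
          algebraMap (fieldOfValues L μ) ℂ s • α₀)
    (k : muAlgValueField L μ) :
    haveI := hμ.numberField_muAlgValueField
    (hOneAlgHom ((AbelianVariety.endAlgebra.mapRingHom ((AμOne (AlgHom.id ℚ L) ι₁ hμ hw Car D).endBaseChange ℂ)).toRingHom.comp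
        (iOne (AlgHom.id ℚ L) ι₁ hμ hw Car D)) k).baseChange ℂ α₀ = ((k : muAlgValueField L μ) : ℂ) • α₀ := by
  haveI := hμ.numberField_muAlgValueField
  let s : fieldOfValues L μ := ⟨(k : ℂ), (mem_fieldOfValues_iff L μ (k : ℂ)).2 k.2⟩
  have e : (letI := lineModuleOne (AlgHom.id ℚ L) ι₁ hμ hw Car D
      DistribSMul.toLinearMap ℚ (bettiCohomology (AμC (AlgHom.id ℚ L) ι₁ hμ hw Car D).X 1) s) =
      hOneAlgHom ((AbelianVariety.endAlgebra.mapRingHom ((AμOne (AlgHom.id ℚ L) ι₁ hμ hw Car D).endBaseChange ℂ)).toRingHom.comp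
        (iOne (AlgHom.id ℚ L) ι₁ hμ hw Car D)) k := by
    apply LinearMap.ext
    intro x
    rw [hOneAlgHom_apply]
    rfl
  have h := hα₀ s
  rw [e] at h
  exact h

/-- **THE WALL CERTIFICATE — `exists_dLiu_of_objOne` is false under the conjugate instance** (granted `hodgePQ_independent_of_hodgeModel`,
the dictionary's `hI`).  For `L/ℚ` Galois CM, the pin `ι₁` with `ι₁ ∈ Φ_μ` (`PhiMu`), any `Algebra L ℂ` structure through
`ῑ₁ = conj ∘ ι₁` (`hinst`), the one object `D : ObjOne (AlgHom.id ℚ L) ι₁ …` of the rest OF RECORD and a non-zero inclusion-eigenclass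
`α₀ ∈ ℂ ⊗ H¹_B(A_μ ⊗_{L,ῑ₁} ℂ; ℚ)`: there is NO `ℚ`-family `dLiu` of model CM records admissible in the dictionary's `ι₁`-reading for `Φ_μ`
together with morphisms `u q : A_μ ⊗_{ῑ₁} ℂ ⟶ (dLiu q).A` obeying the S4 transport law `(f ≫ u q)^* (dLiu q).α = q • f^* α₀`.
REASON (Hodge-type obstruction): `α₀` is of type `(0,1)` — `A_μ ⊗_{ῑ₁} ℂ` realises the CONJUGATE induced reflex type `bar Ψ̃^{ι₁}_μ`
([Liu2021] Def. 4.5 (2) first bullet through `Def45.eta_starRingEnd_comp` and `Def45.inducedCMType_incl_conjugate`, Rem. 4.4) while the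
inclusion `M_μ ⊆ ℂ` lies in `Ψ̃^{ι₁}_μ` (`ι₁ ∈ Φ_μ`) — whereas `u^* (dLiu 1).α = α₀` with `(dLiu 1).α` of type `(1,0)` (an `ι₁`-`Φ_μ`-admissible
record has `τ ∈ ΦA`); a non-zero class cannot have both types.
[cite: Liu2021, Def. 4.3 (2) (FJcycle.tex l. 1919), Remark 4.4 (ll. 1930–1933), Def. 4.5 (1)–(2) (ll. 1939–1951), proof of Thm. 4.18 (l. 2250)]
[cite: Shimura1998, §5.2 (pp. 36–37) and §8.3 Prop. 28] [cite: VoisinHodgeI2002, §7.3.2 and Cor. 6.14] -/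
theorem not_exists_dLiu_isReflexOfTypeG_of_conj_instance (hI : hodgePQ_independent_of_hodgeModel)
    [inst : Algebra (L : Type) ℂ] (hinst : ∀ x : L, algebraMap (L : Type) ℂ x = ((starRingEnd ℂ).comp ι₁) x)
    (hΦ : ι₁ ∈ hμ.cmType.1)
    (D : ObjOne (AlgHom.id ℚ L) ι₁ hμ hw Car)
    (α₀ : ℂ ⊗[ℚ] bettiCohomology (AμC (AlgHom.id ℚ L) ι₁ hμ hw Car D).X 1)
    (hα₀ : letI := lineModuleOne (AlgHom.id ℚ L) ι₁ hμ hw Car D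
      ∀ s : fieldOfValues L μ,
        (DistribSMul.toLinearMap ℚ (bettiCohomology (AμC (AlgHom.id ℚ L) ι₁ hμ hw Car D).X 1) s).baseChange ℂ α₀ =
          algebraMap (fieldOfValues L μ) ℂ s • α₀)
    (hα₀0 : α₀ ≠ 0) :
    ¬ ∃ (dLiu : ℚ → LiuCMSide) (u : ∀ q : ℚ, (AμC (AlgHom.id ℚ L) ι₁ hμ hw Car D).X ⟶ (dLiu q).A.X),
      (∀ Φ' : CMType L, hμ.cmType = Φ' → ∀ q : ℚ, (dLiu q).IsReflexOfTypeG ι₁ Φ') ∧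
      ∀ (q : ℚ) (Y : SchemeOver ℂ) (f : Y ⟶ (AμC (AlgHom.id ℚ L) ι₁ hμ hw Car D).X),
        (BettiUniverse.pull (f ≫ u q) 1).baseChange ℂ (dLiu q).α = (q : ℂ) • (BettiUniverse.pull f 1).baseChange ℂ α₀ := by
  obtain rfl : inst = ((starRingEnd ℂ).comp ι₁).toAlgebra := Algebra.algebra_ext _ _ hinst
  -- re-register the (now explicit) conjugate instance for elaboration of the terms below
  letI : Algebra (L : Type) ℂ := ((starRingEnd ℂ).comp ι₁).toAlgebra
  haveI := hμ.numberField_muAlgValueField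
  rintro ⟨dLiu, u, hadm, hlaw⟩
  -- names
  have hAsp := AbelianVariety.isSmoothProjective_holds (A := AμC (AlgHom.id ℚ L) ι₁ hμ hw Car D)
  /- ### (1,0): the record `d := dLiu 1` is `ι₁`-`Φ_μ`-admissible, so `d.α` is of type `(1,0)`, and `u^* d.α = α₀` -/
  have hd : (dLiu 1).IsReflexOfType ι₁ hμ.cmType := hadm hμ.cmType rfl 1 inferInstance
  have hτd : (dLiu 1).τ ∈ (dLiu 1).ΦA.1 := tau_mem_cmType_of_isReflexOfType' ι₁ (dLiu 1) hμ.cmType hd hΦ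
  have hβd : βA (dLiu 1).A (dLiu 1).α ∈ eigenline (dLiu 1).θA (dLiu 1).τ := by
    rw [← HodgeCM.CM.CommonReflex.map_eigenline_complexify (AbelianVariety.isSmoothProjective_holds (A := (dLiu 1).A))
      (dLiu 1).θA (dLiu 1).isRealisation.isInducedOnIntegers (dLiu 1).τ]
    exact Submodule.mem_map_of_mem (dLiu 1).α_mem
  have h10d : IsOfHodgeType (Module.finrank ℚ (dLiu 1).M / 2) (dLiu 1).A.X 1 1 0 (βA (dLiu 1).A (dLiu 1).α) :=
    ((dLiu 1).isRealisation.2.2.2 (dLiu 1).τ).2.1 hτd _ hβd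
  -- the S4 law at `q = 1`, `f = 𝟙`: `u^* d.α = α₀`
  have hu1 : (BettiUniverse.pull (u 1) 1).baseChange ℂ (dLiu 1).α = α₀ := by
    have h := hlaw 1 _ (𝟙 (AμC (AlgHom.id ℚ L) ι₁ hμ hw Car D).X)
    rwa [Category.id_comp, BettiUniverse.pull_id, LinearMap.baseChange_id, LinearMap.id_apply, Rat.cast_one, one_smul] at h
  have h10 : IsOfHodgeType (AμC (AlgHom.id ℚ L) ι₁ hμ hw Car D).dim (AμC (AlgHom.id ℚ L) ι₁ hμ hw Car D).X 1 1 0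
      (βA (AμC (AlgHom.id ℚ L) ι₁ hμ hw Car D) α₀) := by
    have hmap := h10d.map_of_independent hI hAsp (dLiu 1).isRealisation.1 (nonempty_hodgeModel_holds hAsp).some (u 1)
    rw [complexBetti_map_ofRatClassBaseChangeEquiv hAsp (AbelianVariety.isSmoothProjective_holds (A := (dLiu 1).A)) (u 1)
      (dLiu 1).α] at hmap
    rw [← hu1]
    exact hmap
  /- ### (0,1): `A_μ ⊗_{ῑ₁} ℂ` realises `bar Ψ̃^{ι₁}` on its principal model, and `τ₀ := (M_μ ⊆ ℂ) ∉ bar Ψ̃^{ι₁}` -/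
  -- Def. 4.5 (2) first bullet through `ῑ₁` (`eta_starRingEnd_comp`), principal tail
  obtain ⟨B', u', v', m', hm', huv', hvu', ιB', -, -, -, hreal'⟩ :=
    exists_principal_isCMTypeRealisation_baseChange_of_det45 cotangent_hodge10_comparison_holds
      det_cotangentMap_baseChange_law ((starRingEnd ℂ).comp ι₁) hμ (AμOne (AlgHom.id ℚ L) ι₁ hμ hw Car D)
      (iOne (AlgHom.id ℚ L) ι₁ hμ hw Car D) (hdimOne (AlgHom.id ℚ L) ι₁ hμ hw Car D)
      (fun x M f hM hx => by
        rw [Def45.eta_starRingEnd_comp]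
        exact hdet45One (AlgHom.id ℚ L) ι₁ hμ hw Car D x M f hM hx)
      (Def45.incl (AlgHom.id ℚ L) ((starRingEnd ℂ).comp ι₁) hμ) (Def45.coe_incl (AlgHom.id ℚ L) ((starRingEnd ℂ).comp ι₁) hμ)
  -- the realised type is the conjugate type ([Liu2021] Rem. 4.4)
  have hΨ : inducedCMType (Def45.incl (AlgHom.id ℚ L) ((starRingEnd ℂ).comp ι₁) hμ)
      (reflexCMType ((starRingEnd ℂ).comp ι₁) hμ.cmType (AlgHom.id ℚ L)) =
      bar (inducedCMType (Def45.incl (AlgHom.id ℚ L) ι₁ hμ) (reflexCMType ι₁ hμ.cmType (AlgHom.id ℚ L))) :=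
    Def45.inducedCMType_incl_conjugate (AlgHom.id ℚ L) ι₁ hμ
  -- `τ₀ ∉ bar Ψ̃^{ι₁}` since `τ₀ ∈ Ψ̃^{ι₁}` (`ι₁ ∈ Φ_μ`)
  have hτ₀ : (muAlgValueField L μ).subtype ∉
      (inducedCMType (Def45.incl (AlgHom.id ℚ L) ((starRingEnd ℂ).comp ι₁) hμ)
        (reflexCMType ((starRingEnd ℂ).comp ι₁) hμ.cmType (AlgHom.id ℚ L))).1 := by
    rw [hΨ]
    exact fun h => (mem_bar_iff _ _).1 h (subtype_mem_inducedCMType_incl_of_mem ι₁ hμ hΦ)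
  -- `α₀` read in `H¹(A_μ ⊗_{ῑ₁} ℂ; ℂ)` is a `τ₀`-eigenclass of `complexAction i_{μ,ℂ}`
  have hα₀' : βA (AμC (AlgHom.id ℚ L) ι₁ hμ hw Car D) α₀ ∈
      eigenline (complexAction ((AbelianVariety.endAlgebra.mapRingHom
        ((AμOne (AlgHom.id ℚ L) ι₁ hμ hw Car D).endBaseChange ℂ)).toRingHom.comp (iOne (AlgHom.id ℚ L) ι₁ hμ hw Car D)))
        (muAlgValueField L μ).subtype := by
    rw [eigenline, Submodule.mem_iInf]
    intro k
    rw [Module.End.mem_eigenspace_iff, complexAction_βA, baseChange_hOneAlgHom_of_lineModuleOne' ι₁ hμ hw Car D α₀ hα₀ k,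
      map_smul]
    rfl
  -- its transport `v'^*(β α₀)` is a `τ₀`-eigenclass on the principal model, hence of type `(0,1)`
  have hvα := complexBetti_map_mem_eigenline_transport hm' huv' hvu' _ hα₀'
  have h01B : IsOfHodgeType (Module.finrank ℚ (muAlgValueField L μ) / 2) B'.X 1 0 1
      ((complexBetti.map v'.hom.hom.hom 1).hom (βA (AμC (AlgHom.id ℚ L) ι₁ hμ hw Car D) α₀)) :=
    (hreal'.2.2.2 (muAlgValueField L μ).subtype).2.2 hτ₀ _ hvα
  -- back along `u'`: `u'^* v'^* = m'`, so `α₀` is of type `(0,1)`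
  have h01 : IsOfHodgeType (AμC (AlgHom.id ℚ L) ι₁ hμ hw Car D).dim (AμC (AlgHom.id ℚ L) ι₁ hμ hw Car D).X 1 0 1
      (βA (AμC (AlgHom.id ℚ L) ι₁ hμ hw Car D) α₀) := by
    have hmap := h01B.map_of_isSmoothProjective hAsp hreal'.1 u'.hom.hom.hom
    have hm'' : (m' : ℂ) ≠ 0 := Nat.cast_ne_zero.2 hm'.ne'
    have hmm := complexBetti_map_map_of_comp_eq_nsmul huv' (βA (AμC (AlgHom.id ℚ L) ι₁ hμ hw Car D) α₀)
    erw [hmm] at hmap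
    have h := hmap.smul ((m' : ℂ)⁻¹)
    rwa [inv_smul_smul₀ hm''] at h
  /- ### a non-zero class of two different Hodge types: contradiction -/
  have hzero : βA (AμC (AlgHom.id ℚ L) ι₁ hμ hw Car D) α₀ = 0 :=
    IsOfHodgeType.eq_zero_of_ne hAsp h10 h01 (by decide)
  exact hα₀0 ((map_eq_zero_iff _ (βA (AμC (AlgHom.id ℚ L) ι₁ hμ hw Car D)).injective).1 hzero)

end Junction

end Summit.HodgeConjecture.CorCM.D2Bridge

end
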